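import Literature.AlgebraicGeometry.Motives.GeneratingSectionsOfLineBundle
import Literature.AlgebraicGeometry.Motives.GeneratingSectionsOfCocycleComap
import HarnessLib

/-!
# The generating-sections datum of a family of sections of a line bundle does not depend on the trivialisation

Layer `Literature/AlgebraicGeometry/Motives`, namespace `Literature.AlgebraicGeometry.Motives.GeneratingSections`; theorems only
(no `def`, no instance, no notation, no named fact, no `sorry`).

[Hartshorne1977] II Thm. 7.1 and its proof: for an invertible sheaf `𝓛` on `X` and global sections `t_0, …, t_n` generating it, the
open sets `X_{t_i}` and the functions `t_j/t_i ∈ Γ(X_{t_i}, 𝒪_X)` — hence the morphism `X → ℙⁿ` — are read off in local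
trivialisations `𝓛|_U ≅ 𝒪_U` but do NOT depend on them («`s = f·s₀` … `X_s` is well defined»).  In the tree's coefficient currency
(★ `Motives/GeneratingSectionsOfCocycle`: `CocycleSections ι W` = coefficients `c_i(a) ∈ Γ(X, W a)` of the `t_i` in trivialisations
over a family of opens `W`, glued to `GeneratingSections.ofCocycleSections W S hcov`; ★ `Motives/GeneratingSectionsOfLineBundle`: the
coefficients `coeffAt F h t i x` in a rank-one frame system `F` of `E : X.Modules`, `CocycleSections.ofFrameSystem F h t`) this file
proves that independence:

* §1 `ofCocycleSections_eq_of_rescale` — two coefficient data `S`, `S'` of the same index type over covering families `W`, `W'` whose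
  coefficients differ on `W a ∩ W' b` by UNITS `u_{ab}` not depending on `i` (`c_i(a)| = u_{ab} · c'_i(b)|`) define THE SAME
  generating-sections datum (`X_{t_i}`: `basicOpen_coeff_inf_eq_of_rescale`, `iSup_basicOpen_coeff_le_of_rescale`; ratios: uniqueness ★
  `ofCocycleSections_ratio_unique`, checked locally on the cover by the `W' b` with Mathlib `TopCat.Sheaf.eq_of_locally_eq'`;
  assembled by ★ `eq_of_U_eq`);
* §2 `ofCocycleSections_ofFrameSystem_eq` — for two rank-one frame systems `F`, `F'` of `E` and the same sections `t`, the data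
  `ofCocycleSections F.U (ofFrameSystem F h t)` and `ofCocycleSections F'.U (ofFrameSystem F' h' t)` coincide: the coefficients change by
  the unit `λ_x(b'_y|)` (`map_coeffAt_eq_coord_mul_map_coeffAt`, `isUnit_coord_basisSection`: its inverse is `λ'_y(b_x|)`).

Consumer: (B2) `Motives/CompleteLinearSystemClosedImmersion` of the cell's Lefschetz road («very ample ⟹ every spanning family of
`Γ(𝒪(D))` embeds», stated for an ARBITRARY frame system as B-p20 (g11)'s F-2 (a) package reads it, proved in the canonical frame of
`Modules.lineBundle D.toUnitCocycle`).  Cell hodgecm-mathlib; count-neutral.  HC_CM is proved only modulo the printed citations until rung 0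
closes; this file discharges none of them.

## References
* [Hartshorne1977] R. Hartshorne, *Algebraic Geometry*, GTM 52 (1977), II Thm. 7.1 (p. 150) and its proof («`X_s` is well defined»).
* [GortzWedhorn2020] U. Görtz, T. Wedhorn, *Algebraic Geometry I*, 2nd ed. (2020), Prop. 11.15 (p. 368) (locally free modules and cocycles).
-/

noncomputable section

universe u v w

open CategoryTheory AlgebraicGeometry TopologicalSpace Opposite
open Literature.AlgebraicGeometry.Modules

namespace Literature.AlgebraicGeometry.Motives

namespace GeneratingSections

/-! ### §1 Coefficient data that differ by units chart by chart define the same generating sections -/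

section Rescale

variable {ι : Type} {α : Type v} {β : Type w} {X : Scheme.{u}} {W : α → X.Opens} {W' : β → X.Opens}
  (S : CocycleSections ι W) (S' : CocycleSections ι W')

omit S S' in
/-- Two-step restriction of `𝒪_X` equals any one-step restriction with the same ends. [folklore] -/
private theorem map_map_eq {A B B' : X.Opens} (p : op A ⟶ op B) (q : op B ⟶ op B') (r : op A ⟶ op B')
    (x : Γ(X, A)) : X.presheaf.map q (X.presheaf.map p x) = X.presheaf.map r x := by
  rw [← CommRingCat.comp_apply, ← Functor.map_comp]
  have : p ≫ q = r := congrArg Quiver.Hom.op (Subsingleton.elim (p ≫ q).unop r.unop)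
  rw [this]

omit S S' in
/-- Restrictions along two parallel arrows of opens agree. [folklore] -/
private theorem map_congr_hom {A B : X.Opens} (p q : op A ⟶ op B) (x : Γ(X, A)) :
    X.presheaf.map p x = X.presheaf.map q x := by
  rw [Subsingleton.elim p q]

variable (hW' : ⨆ b, W' b = ⊤) (u : ∀ a b, Γ(X, W a ⊓ W' b)) (hu : ∀ a b, IsUnit (u a b))
  (hc : ∀ i a b, X.presheaf.map (homOfLE (inf_le_left : W a ⊓ W' b ≤ W a)).op (S.coeff i a) =
    u a b * X.presheaf.map (homOfLE (inf_le_right : W a ⊓ W' b ≤ W' b)).op (S'.coeff i b))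

include hu hc in
/-- The non-vanishing loci of the two coefficient families agree on `W a ∩ W' b`. [cite: Hartshorne1977, II proof of Thm. 7.1] -/
theorem basicOpen_coeff_inf_eq_of_rescale (i : ι) (a : α) (b : β) :
    (W a ⊓ W' b) ⊓ X.basicOpen (S.coeff i a) = (W a ⊓ W' b) ⊓ X.basicOpen (S'.coeff i b) := by
  have h1 := X.basicOpen_res (S.coeff i a) (homOfLE (inf_le_left : W a ⊓ W' b ≤ W a)).op
  have h2 := X.basicOpen_res (S'.coeff i b) (homOfLE (inf_le_right : W a ⊓ W' b ≤ W' b)).op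
  rw [hc i a b, X.basicOpen_mul, X.basicOpen_of_isUnit (hu a b), h2, ← inf_assoc, inf_idem] at h1
  exact h1.symm

include hW' hu hc in
/-- The non-vanishing loci `X_{t_i} = ⋃_a X_{c_i(a)} = ⋃_b X_{c'_i(b)}` agree. [cite: Hartshorne1977, II proof of Thm. 7.1] -/
theorem iSup_basicOpen_coeff_le_of_rescale (i : ι) :
    ⨆ a, X.basicOpen (S.coeff i a) ≤ ⨆ b, X.basicOpen (S'.coeff i b) := by
  refine iSup_le fun a x hx => ?_
  have hxW : x ∈ (⨆ b, W' b) := by rw [hW']; trivial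
  obtain ⟨b, hb⟩ := Opens.mem_iSup.mp hxW
  have hmem : x ∈ (W a ⊓ W' b) ⊓ X.basicOpen (S.coeff i a) := ⟨⟨X.basicOpen_le _ hx, hb⟩, hx⟩
  rw [basicOpen_coeff_inf_eq_of_rescale S S' u hu hc i a b] at hmem
  exact Opens.mem_iSup.mpr ⟨b, hmem.2⟩

variable (hW : ⨆ a, W a = ⊤)

include hW hW' hu hc in
/-- **Two coefficient data which differ chart by chart by units define the same generating-sections datum.**  If the
coefficients of the same sections `t_i` in the trivialisations `W a` and `W' b` satisfy `c_i(a)| = u_{ab} · c'_i(b)|` on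
`W a ∩ W' b` for units `u_{ab}` not depending on `i` (change of local generator), and both families of trivialising opens
cover `X`, then the opens `X_{t_i}` and the ratios `t_j/t_i` — hence the morphism to projective space — agree
(Hartshorne II, proof of Thm. 7.1: "`X_s` and `t/s` do not depend on the trivialisation"). [cite: Hartshorne1977, II proof of Thm. 7.1] -/
theorem ofCocycleSections_eq_of_rescale
    (hcov : ⨆ i, ⨆ a, X.basicOpen (S.coeff i a) = ⊤) (hcov' : ⨆ i, ⨆ b, X.basicOpen (S'.coeff i b) = ⊤) :
    ofCocycleSections W S hcov = ofCocycleSections W' S' hcov' := by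
  -- symmetric data for the reverse inequality
  set v : ∀ a b, Γ(X, W a ⊓ W' b) := fun a b => ((hu a b).unit⁻¹ : (Γ(X, W a ⊓ W' b))ˣ) with hvdef
  have hv : ∀ a b, v a b * u a b = 1 := fun a b => (hu a b).unit.inv_mul
  have hvu : ∀ a b, IsUnit (v a b) := fun a b => Units.isUnit _
  have hc' : ∀ i b a, X.presheaf.map (homOfLE (inf_le_left : W' b ⊓ W a ≤ W' b)).op (S'.coeff i b) =
      X.presheaf.map (eqToHom (inf_comm (W' b) (W a))).op (v a b) *
        X.presheaf.map (homOfLE (inf_le_right : W' b ⊓ W a ≤ W a)).op (S.coeff i a) := by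
    intro i b a
    have e1 : X.presheaf.map (homOfLE (inf_le_right : W' b ⊓ W a ≤ W a)).op (S.coeff i a) =
        X.presheaf.map (eqToHom (inf_comm (W' b) (W a))).op
          (X.presheaf.map (homOfLE (inf_le_left : W a ⊓ W' b ≤ W a)).op (S.coeff i a)) :=
      (map_map_eq _ _ _ _).symm
    have e2 : X.presheaf.map (homOfLE (inf_le_left : W' b ⊓ W a ≤ W' b)).op (S'.coeff i b) =
        X.presheaf.map (eqToHom (inf_comm (W' b) (W a))).op
          (X.presheaf.map (homOfLE (inf_le_right : W a ⊓ W' b ≤ W' b)).op (S'.coeff i b)) :=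
      (map_map_eq _ _ _ _).symm
    rw [e1, e2, hc i a b, map_mul, ← mul_assoc, ← map_mul, hv, map_one, one_mul]
  have hv_unit : ∀ b a, IsUnit (X.presheaf.map (eqToHom (inf_comm (W' b) (W a))).op (v a b)) := fun b a =>
    (hvu a b).map _
  have hU : ∀ i, (ofCocycleSections W S hcov).U i = (ofCocycleSections W' S' hcov').U i := fun i =>
    le_antisymm (iSup_basicOpen_coeff_le_of_rescale S S' hW' u hu hc i)
      (iSup_basicOpen_coeff_le_of_rescale S' S hW (fun b a => X.presheaf.map (eqToHom (inf_comm (W' b) (W a))).op (v a b))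
        hv_unit hc' i)
  refine eq_of_U_eq hU fun i j => ?_
  symm
  refine ofCocycleSections_ratio_unique W S hcov i j _ fun a => ?_
  -- check the defining formula of the ratio on `X_{c_i(a)}`, locally on the cover by the `W' b`
  set B : X.Opens := X.basicOpen (S.coeff i a) with hB
  refine X.sheaf.eq_of_locally_eq' (fun b : β => B ⊓ W' b) B (fun b => homOfLE inf_le_left)
    (by rw [← inf_iSup_eq, hW', inf_top_eq]) _ _ fun b => ?_
  -- on `V = X_{c_i(a)} ∩ W' b ⊆ W a ∩ W' b`
  have hVab : B ⊓ W' b ≤ W a ⊓ W' b := inf_le_inf_right _ (X.basicOpen_le _)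
  have hVb' : B ⊓ W' b ≤ X.basicOpen (S'.coeff i b) := fun x hx => by
    have : x ∈ (W a ⊓ W' b) ⊓ X.basicOpen (S.coeff i a) := ⟨hVab hx, hx.1⟩
    rw [basicOpen_coeff_inf_eq_of_rescale S S' u hu hc i a b] at this
    exact this.2
  have hVU' : B ⊓ W' b ≤ (ofCocycleSections W' S' hcov').U i :=
    hVb'.trans (basicOpen_le_ofCocycleSections_U W' S' hcov' i b)
  -- the defining formula for `S'` on `X_{c'_i(b)}`, restricted to `V`
  have key := congrArg (X.presheaf.map (homOfLE hVb').op) (ofCocycleSections_ratio_res_mul W' S' hcov' i j b)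
  rw [map_mul] at key
  -- coefficients of `S` on `V` in terms of those of `S'`
  have hci : X.presheaf.map (homOfLE (inf_le_left : B ⊓ W' b ≤ B)).op
        (X.presheaf.map (homOfLE (X.basicOpen_le (S.coeff i a))).op (S.coeff i a)) =
      X.presheaf.map (homOfLE hVab).op (u a b) *
        X.presheaf.map (homOfLE hVb').op
          (X.presheaf.map (homOfLE (X.basicOpen_le (S'.coeff i b))).op (S'.coeff i b)) := by
    rw [map_map_eq _ _ (homOfLE (hVab.trans inf_le_left)).op, map_map_eq _ _ (homOfLE (hVab.trans inf_le_right)).op,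
      ← map_map_eq (homOfLE (inf_le_left : W a ⊓ W' b ≤ W a)).op (homOfLE hVab).op (homOfLE (hVab.trans inf_le_left)).op,
      hc i a b, map_mul]
    congr 1
    exact map_map_eq _ _ _ _
  have hcj : X.presheaf.map (homOfLE (inf_le_left : B ⊓ W' b ≤ B)).op
        (X.presheaf.map (homOfLE (X.basicOpen_le (S.coeff i a))).op (S.coeff j a)) =
      X.presheaf.map (homOfLE hVab).op (u a b) *
        X.presheaf.map (homOfLE hVb').op
          (X.presheaf.map (homOfLE (X.basicOpen_le (S'.coeff i b))).op (S'.coeff j b)) := by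
    rw [map_map_eq _ _ (homOfLE (hVab.trans inf_le_left)).op, map_map_eq _ _ (homOfLE (hVab.trans inf_le_right)).op,
      ← map_map_eq (homOfLE (inf_le_left : W a ⊓ W' b ≤ W a)).op (homOfLE hVab).op (homOfLE (hVab.trans inf_le_left)).op,
      hc j a b, map_mul]
    congr 1
    exact map_map_eq _ _ _ _
  change X.presheaf.map (homOfLE (inf_le_left : B ⊓ W' b ≤ B)).op (_ * _) =
    X.presheaf.map (homOfLE (inf_le_left : B ⊓ W' b ≤ B)).op _
  rw [map_mul, hci, hcj, ← key]
  have hBU' : B ≤ (ofCocycleSections W' S' hcov').U i :=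
    (basicOpen_le_ofCocycleSections_U W S hcov i a).trans (hU i).le
  have hr : X.presheaf.map (homOfLE (inf_le_left : B ⊓ W' b ≤ B)).op
      (X.presheaf.map (homOfLE (basicOpen_le_ofCocycleSections_U W S hcov i a)).op
        (X.presheaf.map (eqToHom (hU i)).op ((ofCocycleSections W' S' hcov').ratio i j))) =
      X.presheaf.map (homOfLE hVb').op
        (X.presheaf.map (homOfLE (basicOpen_le_ofCocycleSections_U W' S' hcov' i b)).op
          ((ofCocycleSections W' S' hcov').ratio i j)) := by
    rw [map_map_eq (eqToHom (hU i)).op _ (homOfLE hBU').op, map_map_eq _ _ (homOfLE hVU').op,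
      map_map_eq _ _ (homOfLE hVU').op]
  rw [hr]
  ring

end Rescale

/-! ### §2 Independence of the frame system -/

section Frames

variable {X : Scheme.{u}} {E : X.Modules} (F F' : FrameSystem E) (h : ∀ x, F.rank x = 1) (h' : ∀ x, F'.rank x = 1)
  {ι : Type} (t : ι → Γ(E, ⊤))

/-- **Change of frame for the coefficients**: on `U_x ∩ U'_y`, `c_i(x) = u · c'_i(y)` with `u = λ_x(b'_y|)` the coordinate of
the generator of `F'` at `y` in the generator of `F` at `x`. [cite: Hartshorne1977, II proof of Thm. 7.1] -/
theorem map_coeffAt_eq_coord_mul_map_coeffAt (i : ι) (x y : X) :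
    X.presheaf.map (homOfLE (inf_le_left : F.U x ⊓ F'.U y ≤ F.U x)).op (coeffAt F h t i x) =
      coord (F.frame x) (homOfLE (inf_le_left : F.U x ⊓ F'.U y ≤ F.U x))
          (E.presheaf.map (homOfLE (inf_le_right : F.U x ⊓ F'.U y ≤ F'.U y)).op
            (basisSection (F'.frame y) (F'.idx h' y))) (F.idx h x) *
        X.presheaf.map (homOfLE (inf_le_right : F.U x ⊓ F'.U y ≤ F'.U y)).op (coeffAt F' h' t i y) := by
  classical
  rw [map_coeffAt F h t i x (inf_le_left : F.U x ⊓ F'.U y ≤ F.U x),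
    map_top_eq_map_coeffAt_smul F' h' t i y (inf_le_right : F.U x ⊓ F'.U y ≤ F'.U y),
    F.eq_coord_smul_gen h (homOfLE (inf_le_left : F.U x ⊓ F'.U y ≤ F.U x))
      (E.presheaf.map (homOfLE (inf_le_right : F.U x ⊓ F'.U y ≤ F'.U y)).op
        (basisSection (F'.frame y) (F'.idx h' y)))]
  simp only [coord_smul, coord_map_basisSection]
  ring

/-- The frame-change coefficient `λ_x(b'_y|)` is a unit on `U_x ∩ U'_y` (its inverse is `λ'_y(b_x|)`).
[cite: Hartshorne1977, II proof of Thm. 7.1] -/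
theorem isUnit_coord_basisSection (x y : X) :
    IsUnit (coord (F.frame x) (homOfLE (inf_le_left : F.U x ⊓ F'.U y ≤ F.U x))
      (E.presheaf.map (homOfLE (inf_le_right : F.U x ⊓ F'.U y ≤ F'.U y)).op
        (basisSection (F'.frame y) (F'.idx h' y))) (F.idx h x)) := by
  classical
  set V : X.Opens := F.U x ⊓ F'.U y
  set bx := E.presheaf.map (homOfLE (inf_le_left : V ≤ F.U x)).op (basisSection (F.frame x) (F.idx h x)) with hbx
  set by' := E.presheaf.map (homOfLE (inf_le_right : V ≤ F'.U y)).op (basisSection (F'.frame y) (F'.idx h' y))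
    with hby
  set u := coord (F.frame x) (homOfLE (inf_le_left : V ≤ F.U x)) by' (F.idx h x) with hu
  set u' := coord (F'.frame y) (homOfLE (inf_le_right : V ≤ F'.U y)) bx (F'.idx h' y) with hu'
  -- `b_x| = u' • b'_y|` and `b'_y| = u • b_x|`
  have h1 : bx = u' • by' := F'.eq_coord_smul_gen h' (homOfLE (inf_le_right : V ≤ F'.U y)) bx
  have h2 : by' = u • bx := F.eq_coord_smul_gen h (homOfLE (inf_le_left : V ≤ F.U x)) by'
  have h3 : coord (F.frame x) (homOfLE (inf_le_left : V ≤ F.U x)) bx (F.idx h x) = 1 := by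
    rw [hbx, coord_map_basisSection, if_pos rfl]
  have h4 : u' * u = 1 := by
    have this : coord (F.frame x) (homOfLE (inf_le_left : V ≤ F.U x)) bx (F.idx h x) =
        coord (F.frame x) (homOfLE (inf_le_left : V ≤ F.U x)) (u' • by') (F.idx h x) := by rw [← h1]
    rw [h2, smul_smul, coord_smul, h3, mul_one] at this
    exact this.symm
  exact isUnit_iff_exists_inv.mpr ⟨u', by rw [mul_comm]; exact h4⟩

omit h in
/-- The opens of a frame system cover. [folklore] -/
private theorem iSup_frameSystem_U_eq_top : ⨆ x, F.U x = ⊤ :=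
  eq_top_iff.mpr fun x _ => Opens.mem_iSup.mpr ⟨x, F.mem x⟩

/-- **The generating-sections datum of a family of sections of a line bundle does not depend on the frame system**
used to read off the coefficients (same opens `X_{t_i}`, same ratios `t_j/t_i`); in particular the morphism
`(ofCocycleSections F.U (ofFrameSystem F h t) _).toProj f` to projective space is intrinsic to `(E, t)`.
[cite: Hartshorne1977, II Thm. 7.1] -/
theorem ofCocycleSections_ofFrameSystem_eq
    (hcov : ⨆ i, ⨆ x, X.basicOpen ((CocycleSections.ofFrameSystem F h t).coeff i x) = ⊤)
    (hcov' : ⨆ i, ⨆ x, X.basicOpen ((CocycleSections.ofFrameSystem F' h' t).coeff i x) = ⊤) :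
    ofCocycleSections F.U (CocycleSections.ofFrameSystem F h t) hcov =
      ofCocycleSections F'.U (CocycleSections.ofFrameSystem F' h' t) hcov' :=
  ofCocycleSections_eq_of_rescale (CocycleSections.ofFrameSystem F h t) (CocycleSections.ofFrameSystem F' h' t)
    (iSup_frameSystem_U_eq_top F')
    (fun x y => coord (F.frame x) (homOfLE (inf_le_left : F.U x ⊓ F'.U y ≤ F.U x))
      (E.presheaf.map (homOfLE (inf_le_right : F.U x ⊓ F'.U y ≤ F'.U y)).op
        (basisSection (F'.frame y) (F'.idx h' y))) (F.idx h x))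
    (fun x y => isUnit_coord_basisSection F F' h h' x y)
    (fun i x y => map_coeffAt_eq_coord_mul_map_coeffAt F F' h h' t i x y)
    (iSup_frameSystem_U_eq_top F) hcov hcov'

end Frames

end GeneratingSections

end Literature.AlgebraicGeometry.Motives

end
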